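/-
Origin: expansion seat `planner-pub-hodgecm-toy2-g2-0`, handover #3 2026-08-18T05:04:00Z (`HOME/pub-hodgecm-toy2-g2/lean/Toy2g2/StarDual.lean`, md5 b4e5041d, 181 lines);
landed by the gen-6 packager in gate run 22 as `HodgeCM/Model/Toy/StarDual.lean` (import ^import Toy2g2\.Star(Top|Dual|Obj|Hodge|AlgDuality)\b→import HodgeCM.Model.Toy.Star\1 ×1).
-/
/-
Copyright: pub-hodgecm formalisation cell (harness21, 2026). New file (not vendored).
Origin: HOME/pub-hodgecm-toy2-g2/lean/Toy2g2/StarDual.lean (WIP module `Toy2g2.StarDual`; intended final place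
`HodgeCM/Model/Toy/StarDual.lean` = module `HodgeCM.Model.Toy.StarDual`, CONTRIBUTING §3 L5) (seat
planner-pub-hodgecm-toy2-g2-0, consistency seat 2 gen 2, towards M28 `Fact_algDuality` in the toy universe).
-/
import Summits.HodgeConjecture.HodgeCM.Model.Toy.StarTop
import Summits.HodgeConjecture.HodgeCM.Model.Toy.Exterior

/-!
# The star operator of a bilinear form on complementary exterior powers

For a finite-dimensional `R`-space `V` of dimension `k + l` and a bilinear form `b` on `V` we construct the linear map
`star : ⋀^k V → ⋀^l V` characterised by

  `x ∧ star y = β(x, y) · vol`   (`wedge_star`),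

where `β = ⋀^k b` is the Gram-determinant form `β(u₁ ∧ … ∧ u_k, w₁ ∧ … ∧ w_k) = det (b(u_j, w_i))` (Mathlib's
`exteriorPower.pairingDual` composed with `⋀^k` of `b : V → V^*`) and `vol` is a fixed generator of the top power.  We prove:

* `star_twisted_equivariance`: if `b(g'u, w) = b(u, gw)` for all `u, w` and `g'` is invertible then
  `⋀^l g' ∘ star ∘ ⋀^k g = det g' · star`;
* `star_bijective`: `star` is bijective when `b` is nondegenerate.

No basis enters the statements; bases are used only inside proofs (`StarTop`).
-/

noncomputable section

namespace HodgeCM.Toy.Star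

open exteriorPower Module Set Set.powersetCard

variable {R : Type*} [Field R] {V : Type*} [AddCommGroup V] [Module R V] [FiniteDimensional R V]
variable {k l : ℕ} (hV : Module.finrank R V = k + l)

/-! ### A generator of the top power and the wedge pairing -/

/-- an auxiliary basis of `V` indexed by `Fin (k + l)` -/
def bV : Basis (Fin (k + l)) R V := (Module.finBasis R V).reindex (finCongr hV)

omit [FiniteDimensional R V] in
/-- (Ported verbatim from the HodgeCMPerL package; no docstring in the source.) -/
lemma card_fin_kl : Fintype.card (Fin (k + l)) = k + l := Fintype.card_fin _

/-- the generator `vol` of the top power `⋀^{k+l} V` -/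
def vol : ⋀[R]^(k + l) V := (bV hV).exteriorPower (k + l) (univC card_fin_kl)

/-- the coordinate along `vol` -/
def lam : ⋀[R]^(k + l) V →ₗ[R] R := ((bV hV).exteriorPower (k + l)).coord (univC card_fin_kl)

/-- (Ported verbatim from the HodgeCMPerL package; no docstring in the source.) -/
lemma eq_lam_smul_vol (z : ⋀[R]^(k + l) V) : z = lam hV z • vol hV := eq_coord_smul_top _ _ z

/-- (Ported verbatim from the HodgeCMPerL package; no docstring in the source.) -/
lemma vol_ne_zero : vol hV ≠ 0 := Basis.ne_zero _ _

/-- the wedge pairing `W(x, z) = lam (x ∧ z)` on `⋀^k V × ⋀^l V` -/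
def W : ⋀[R]^k V →ₗ[R] ⋀[R]^l V →ₗ[R] R := (wedge R V k l).compr₂ (lam hV)

/-- (Ported verbatim from the HodgeCMPerL package; no docstring in the source.) -/
lemma W_apply (x : ⋀[R]^k V) (z : ⋀[R]^l V) : W hV x z = lam hV (wedge R V k l x z) := rfl

/-- (Ported verbatim from the HodgeCMPerL package; no docstring in the source.) -/
lemma wedge_eq_W_smul_vol (x : ⋀[R]^k V) (z : ⋀[R]^l V) : wedge R V k l x z = W hV x z • vol hV :=
  eq_lam_smul_vol hV _

/-- The wedge pairing has no right kernel. -/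
theorem W_flip_injective : Function.Injective (W hV).flip := by
  rw [← LinearMap.ker_eq_bot, LinearMap.ker_eq_bot']
  intro z hz
  apply eq_zero_of_forall_basis_mul_eq_zero (bV hV) card_fin_kl.symm z
  intro S
  have h1 : W hV ((bV hV).exteriorPower k S) z = 0 := by
    rw [← LinearMap.flip_apply, hz, LinearMap.zero_apply]
  rw [← wedge_coe, wedge_eq_W_smul_vol hV, h1, zero_smul, Submodule.coe_zero]

include hV in
/-- (Ported verbatim from the HodgeCMPerL package; no docstring in the source.) -/
lemma finrank_wedge_eq : Module.finrank R (⋀[R]^l V) = Module.finrank R (Module.Dual R (⋀[R]^k V)) := by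
  rw [Subspace.dual_finrank_eq, finrank_eq, finrank_eq, hV, Nat.choose_symm_add]

/-- (Ported verbatim from the HodgeCMPerL package; no docstring in the source.) -/
theorem W_flip_bijective : Function.Bijective (W hV).flip :=
  ⟨W_flip_injective hV,
    (LinearMap.injective_iff_surjective_of_finrank_eq_finrank (finrank_wedge_eq hV)).mp (W_flip_injective hV)⟩

/-- `⋀^l V ≃ (⋀^k V)^*` by the wedge pairing -/
def WE : ⋀[R]^l V ≃ₗ[R] Module.Dual R (⋀[R]^k V) := LinearEquiv.ofBijective _ (W_flip_bijective hV)

/-- (Ported verbatim from the HodgeCMPerL package; no docstring in the source.) -/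
lemma WE_apply (z : ⋀[R]^l V) (x : ⋀[R]^k V) : WE hV z x = W hV x z := rfl

/-! ### The Gram-determinant form `β = ⋀^k b` and the star operator -/

variable (b : LinearMap.BilinForm R V)

/-- `β = ⋀^k b : ⋀^k V → (⋀^k V)^*` -/
def β : ⋀[R]^k V →ₗ[R] Module.Dual R (⋀[R]^k V) := pairingDual R V k ∘ₗ map k b

omit [FiniteDimensional R V] in
/-- (Ported verbatim from the HodgeCMPerL package; no docstring in the source.) -/
lemma β_ιMulti (u w : Fin k → V) :
    β b (ιMulti R k u) (ιMulti R k w) = (Matrix.of fun i j => b (u j) (w i)).det := by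
  simp [β, map_apply_ιMulti, pairingDual_ιMulti_ιMulti]

/-- **The star operator** of `b`: `star : ⋀^k V → ⋀^l V`, `x ∧ star y = β(x, y) vol`. -/
def star : ⋀[R]^k V →ₗ[R] ⋀[R]^l V := (WE hV).symm.toLinearMap ∘ₗ (β b).flip

/-- (Ported verbatim from the HodgeCMPerL package; no docstring in the source.) -/
lemma star_apply (y : ⋀[R]^k V) : star hV b y = (WE hV).symm ((β b).flip y) := rfl

/-- (Ported verbatim from the HodgeCMPerL package; no docstring in the source.) -/
theorem W_star (x y : ⋀[R]^k V) : W hV x (star hV b y) = β b x y := by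
  rw [← WE_apply, star_apply, LinearEquiv.apply_symm_apply, LinearMap.flip_apply]

/-- **Wedge characterisation** of the star operator. -/
theorem wedge_star (x y : ⋀[R]^k V) : wedge R V k l x (star hV b y) = β b x y • vol hV := by
  rw [wedge_eq_W_smul_vol hV, W_star]

omit [FiniteDimensional R V] in
/-- `β(⋀^k g x, y) = β(x, ⋀^k g' y)` for a `b`-adjoint pair `(g, g')`. -/
theorem β_map_map {g g' : V →ₗ[R] V} (hadj : ∀ u w, b (g u) w = b u (g' w)) (x y : ⋀[R]^k V) :
    β b (map k g x) y = β b x (map k g' y) := by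
  have key : (β b) ∘ₗ map k g = (map k g').dualMap ∘ₗ β b := by
    apply linearMap_ext
    refine AlternatingMap.ext fun u => ?_
    apply linearMap_ext
    refine AlternatingMap.ext fun w => ?_
    simp only [LinearMap.compAlternatingMap_apply, LinearMap.comp_apply, map_apply_ιMulti,
      LinearMap.dualMap_apply, β_ιMulti, Function.comp_apply, hadj]
  simpa using congrArg (fun F => F x y) key

/-- **Twisted equivariance**: `⋀^l g' ∘ star ∘ ⋀^k g = det g' · star` whenever `b(g'u, w) = b(u, gw)` and `g'` is
invertible. -/
theorem star_twisted_equivariance {g g' : V →ₗ[R] V} (hadj' : ∀ u w, b (g' u) w = b u (g w))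
    (hg' : Function.Bijective g') :
    map l g' ∘ₗ star hV b ∘ₗ map k g = LinearMap.det g' • star hV b := by
  apply LinearMap.ext
  intro y
  apply W_flip_injective hV
  apply LinearMap.ext
  intro x
  simp only [LinearMap.flip_apply, LinearMap.comp_apply, LinearMap.smul_apply]
  let G : V ≃ₗ[R] V := LinearEquiv.ofBijective g' hg'
  have hx : map k g' (map k (G.symm : V →ₗ[R] V) x) = x := by
    rw [← LinearMap.comp_apply, ← map_comp]
    have : g' ∘ₗ (G.symm : V →ₗ[R] V) = LinearMap.id := by
      ext v
      exact G.apply_symm_apply v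
    rw [this, map_id, LinearMap.id_apply]
  rw [← hx, W_apply, ← map_wedge, map_eq_det_smul hV, map_smul, ← W_apply, W_star, ← β_map_map b hadj', hx,
    map_smul, W_star, smul_eq_mul]

include hV in
/-- `β` is nondegenerate (in the second slot) when `b` is. -/
theorem β_flip_injective (hb : b.Nondegenerate) : Function.Injective (β (k := k) b).flip := by
  rw [← LinearMap.ker_eq_bot, LinearMap.ker_eq_bot']
  intro y hy
  let e := bV hV
  let e' := b.dualBasis hb e
  have h₁ : ∀ i, (b ∘ e') i (e i) = 1 := fun i => by simp [e', LinearMap.BilinForm.apply_dualBasis_left]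
  have h₀ : ∀ ⦃i j⦄, i ≠ j → (b ∘ e') i (e j) = 0 := fun i j hij => by
    simp [e', LinearMap.BilinForm.apply_dualBasis_left, Ne.symm hij]
  have key : ∀ S : powersetCard (Fin (k + l)) k, β b (e'.exteriorPower k S) = (e.exteriorPower k).coord S := by
    intro S
    apply (e.exteriorPower k).ext
    intro T
    rw [Basis.coord_apply, Basis.repr_self, basis_apply, basis_apply, β, LinearMap.comp_apply,
      map_apply_ιMulti_family, ιMulti_family, ιMulti_family, Finsupp.single_apply]
    by_cases hST : S = T
    · subst hST
      rw [if_pos rfl]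
      exact pairingDual_apply_apply_eq_one e (b ∘ e') h₁ h₀ k _
    · rw [if_neg (fun h => hST h.symm)]
      exact pairingDual_apply_apply_eq_one_zero e (b ∘ e') h₀ k _ _
        (fun h => hST (ofFinEmbEquiv.symm.injective h))
  refine (e.exteriorPower k).repr.injective (Finsupp.ext fun S => ?_)
  have := LinearMap.congr_fun hy (e'.exteriorPower k S)
  rw [LinearMap.flip_apply, key, LinearMap.zero_apply, Basis.coord_apply] at this
  rw [this, map_zero, Finsupp.zero_apply]

/-- **The star operator of a nondegenerate form is bijective.** -/
theorem star_bijective (hb : b.Nondegenerate) : Function.Bijective (star hV b) := by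
  have hβ : Function.Bijective (β b).flip :=
    ⟨β_flip_injective hV b hb, (LinearMap.injective_iff_surjective_of_finrank_eq_finrank
      (Subspace.dual_finrank_eq).symm).mp (β_flip_injective hV b hb)⟩
  exact (WE hV).symm.bijective.comp hβ

end HodgeCM.Toy.Star

end
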